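import Summits.CriticalPhenomena.PercolationContinuityZ3.Theorems.PercAnnulusCrossingIICNearCriticalSchemeLevel
import Summits.CriticalPhenomena.PercolationContinuityZ3.Theorems.PercAnnulusCrossingIICAspectSchemeHypotheses
import HarnessLib

/-!
# Kesten–Basu–Sapozhnikov IIC scheme in boxes, NEAR-CRITICAL series V: hypothesis `hU` of Kesten's ratio scheme for an ABSTRACT junk
# weight (lane RSW3, p1 gen 6)

builds on p205010 (kernel theorem, internal audit signed; external expert review pending)

Seat `prim-rsw3-p1` (gen 6).  The last theorem of part XVI′ (`PercAnnulusCrossingIICAspectSchemeHypotheses.lean`, `scheme_sum_two_sided_junk`)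
re-threaded for an ABSTRACT junk weight `J : ℕ → ℕ → ℝ` (hypothesis `hJ`: the level-junk inequality, series II); the junk-size hypothesis
becomes `J μ₁ μ₂ + J M₁ M₂ ≤ ϰ² ε`.  The other theorems of part XVI′ (`kernel_le_dat_aspect`, `kernel_pos_aspect`,
`kernel_eq_zero_of_beta_eq_zero_aspect`) involve no junk and are used as is.  Proof = part XVI′ verbatim.  Helper file; no definitions,
no sorries; every `p`, `d`.
* **`scheme_sum_two_sided_junk`** — over `s = {D : γ_n(D) > 0, P(DAT(D)) > 0, β(D) > 0}`, for `p > 0`, `J μ₁ μ₂ + J M₁ M₂ ≤ ϰ² ε`, `τ M₂ < N ≤ n`: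
  `(1 − ε) γ_N(C) ≤ Σ_{D ∈ s} M(C;D) γ_N(D) ≤ γ_N(C)`.
References: H. Kesten, PTRF 73 (1986) §2 eq. (22); D. Basu, A. Sapozhnikov, ECP 22 (2017) no. 26, §2.
-/

noncomputable section

namespace Summit.CriticalPhenomena.PercolationContinuityZ3.Theorems.Crossing

open MeasureTheory Literature.Probability.Percolation Literature.Probability.LatticeModels
open Literature.Probability.Percolation.DCT16
open Summit.CriticalPhenomena.PercolationContinuityZ3.Theorems.SurfaceTension
open scoped Literature.Probability.Percolation

variable {d : ℕ}

/-- **Hypothesis `hU` of Kesten's scheme, ABSTRACT junk weight `J`** over the index set `s = {D : γ_n(D) > 0, P(DAT(D)) > 0, β(D) > 0}`: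
for `p > 0`, junk `J μ₁ μ₂ + J M₁ M₂ ≤ ϰ² ε` and `τ M₂ < N ≤ n` (general aspect):  `(1 − ε) γ_N(C) ≤ Σ_{D ∈ s} M(C;D) γ_N(D) ≤ γ_N(C)`.
[cite: Kesten1986, §2 eq. (22)] -/
theorem scheme_sum_two_sided_junk (p : unitInterval) (hp : 0 < (p : ℝ)) {ϰ ε : ℝ} (hϰ : 0 < ϰ)
    {σ τ : ℕ → ℕ} (hσ : ∀ m : ℕ, 1 ≤ m → m < σ m) (hστ : ∀ m : ℕ, 1 ≤ m → σ m < τ m)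
    (hσm : Monotone σ) (hτm : Monotone τ)
    (hA2 : ∀ m : ℕ, 1 ≤ m → ∀ Z : Finset (Site d), box d (τ m) \ box d (m - 1) ⊆ Z →
      ∀ X : Finset (Site d), X ⊆ Z ∩ box d m → ∀ Y : Finset (Site d), Y ⊆ Z \ box d (τ m) →
        ϰ * (bondPercolation (zdGraph d) p).real {ω | ∃ x ∈ X, ∃ s ∈ innerBoundary (zdGraph d) (box d (σ m)),
              ω ∈ openConnIn (↑Z : Set (Site d)) x s} *
          (bondPercolation (zdGraph d) p).real {ω | ∃ y ∈ Y, ∃ s ∈ innerBoundary (zdGraph d) (box d (σ m)),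
              ω ∈ openConnIn (↑Z : Set (Site d)) y s} ≤
        (bondPercolation (zdGraph d) p).real {ω | ∃ x ∈ X, ∃ y ∈ Y, ω ∈ openConnIn (↑Z : Set (Site d)) x y})
    (J : ℕ → ℕ → ℝ)
    (hJ : ∀ ⦃m₁ m₂ n : ℕ⦄, 1 ≤ m₁ → m₁ ≤ m₂ → τ m₁ < σ m₂ → τ m₂ < n →
      ∀ ⦃H X : Finset (Site d)⦄, H ⊆ box d (m₁ - 1) → X ⊆ box d m₁ → (∀ x ∈ X, x ∉ H) →
      ϰ ^ 2 * (bondPercolation (zdGraph d) p).real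
          ({ω : BondConfig (Site d) | ∃ x ∈ X, ∃ t ∈ innerBoundary (zdGraph d) (box d n),
              ω ∈ openConnIn ((↑(box d n) : Set (Site d)) \ ↑H) x t} ∩
           {ω : BondConfig (Site d) | ∃ t₁ ∈ innerBoundary (zdGraph d) (box d (σ m₁)), ∃ w₁ ∈ innerBoundary (zdGraph d) (box d (σ m₂)),
               ∃ t₂ ∈ innerBoundary (zdGraph d) (box d (σ m₁)), ∃ w₂ ∈ innerBoundary (zdGraph d) (box d (σ m₂)),
               ω ∩ {e : Sym2 (Site d) | e ∈ (↑((box d (σ m₂)).sym2) : Set (Sym2 (Site d))) ∧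
                   ¬ (∀ v ∈ e, v ∈ box d (σ m₁)) ∧ ¬ (∀ v ∈ e, v ∈ innerBoundary (zdGraph d) (box d (σ m₂)))} ∈
                 openConnIn (↑(box d (σ m₂)) : Set (Site d)) t₁ w₁ ∧
               ω ∩ {e : Sym2 (Site d) | e ∈ (↑((box d (σ m₂)).sym2) : Set (Sym2 (Site d))) ∧
                   ¬ (∀ v ∈ e, v ∈ box d (σ m₁)) ∧ ¬ (∀ v ∈ e, v ∈ innerBoundary (zdGraph d) (box d (σ m₂)))} ∈
                 openConnIn (↑(box d (σ m₂)) : Set (Site d)) t₂ w₂ ∧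
               ω ∩ {e : Sym2 (Site d) | e ∈ (↑((box d (σ m₂)).sym2) : Set (Sym2 (Site d))) ∧
                   ¬ (∀ v ∈ e, v ∈ box d (σ m₁)) ∧ ¬ (∀ v ∈ e, v ∈ innerBoundary (zdGraph d) (box d (σ m₂)))} ∉
                 openConnIn (↑(box d (σ m₂)) : Set (Site d)) w₁ w₂}) ≤
        J m₁ m₂ * (bondPercolation (zdGraph d) p).real {ω : BondConfig (Site d) | ∃ x ∈ X, ∃ t ∈ innerBoundary (zdGraph d) (box d n),
            ω ∈ openConnIn ((↑(box d n) : Set (Site d)) \ ↑H) x t})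
    {mm μ₁ μ₂ M₁ M₂ n N : ℕ} (hmμ : τ (σ mm + 1) + 2 ≤ σ μ₁) (hμ12 : τ μ₁ < σ μ₂) (hμM : μ₂ ≤ M₁) (hM : τ M₁ < σ M₂)
    (hN : τ M₂ < N) (hNn : N ≤ n)
    (hjunk : J μ₁ μ₂ + J M₁ M₂ ≤ ϰ ^ 2 * ε)
    {H X : Finset (Site d)} (hH : H ⊆ box d (σ mm)) (hX : X ⊆ box d (σ mm + 1)) (hXH : ∀ x ∈ X, x ∉ H) :
    (1 - ε) * (bondPercolation (zdGraph d) p).real {ω : BondConfig (Site d) | ∃ x ∈ X, ∃ t ∈ innerBoundary (zdGraph d) (box d N),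
            ω ∈ openConnIn ((↑(box d N) : Set (Site d)) \ ↑H) x t} ≤
      ∑ D ∈ (((box d (σ M₂)).powerset.filter (fun U => box d (σ M₁) ⊆ U)) ×ˢ (box d (σ M₂ + 1)).powerset).filter (fun D =>
          0 < (bondPercolation (zdGraph d) p).real {ω : BondConfig (Site d) | ∃ x ∈ D.2, ∃ t ∈ innerBoundary (zdGraph d) (box d n),
            ω ∈ openConnIn ((↑(box d n) : Set (Site d)) \ ↑D.1) x t} ∧
          0 < (bondPercolation (zdGraph d) p).real {ω : BondConfig (Site d) | ω ∩ (↑((box d (σ M₂ + 1)).sym2) : Set (Sym2 (Site d))) ∈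
            explEvent (↑(box d (σ M₁)) : Set (Site d)) ((↑(box d (σ M₂)) : Set (Site d)) \ ↑(box d (σ M₁))) ↑D.1 ↑D.2} ∧
          0 < (∑ I ∈ (box d (σ μ₂ - 1) \ box d (σ μ₁ - 1)).powerset ×ˢ (innerBoundary (zdGraph d) (box d (σ μ₁ - 1))).powerset,
        (bondPercolation (zdGraph d) p).real {ω : BondConfig (Site d) | ∃ y ∈ I.2, ∃ w ∈ innerBoundary (zdGraph d) (box d (σ (σ mm + 1))),
          ω ∈ openConnIn ((↑(box d (σ μ₂)) : Set (Site d)) \ (↑(I.1 ∪ innerBoundary (zdGraph d) (box d (σ μ₂))) ∪ ↑(box d (σ (σ mm + 1) - 1)))) y w} *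
        (bondPercolation (zdGraph d) p).real
          ({ω : BondConfig (Site d) | ω ∩ (↑((box d (σ μ₂)).sym2) : Set (Sym2 (Site d))) ∈
                explEvent ((↑(box d (σ μ₂ - 1)) : Set (Site d))ᶜ) ((↑(box d (σ μ₂ - 1)) : Set (Site d)) \ ↑(box d (σ μ₁ - 1)))
                  ((↑(box d (σ μ₂ - 1)) : Set (Site d))ᶜ ∪ ↑I.1) ↑I.2} ∩
           {ω : BondConfig (Site d) | ∀ y ∈ I.2, ∀ y' ∈ I.2, ∀ z ∈ I.1 ∪ innerBoundary (zdGraph d) (box d (σ μ₂)),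
                ∀ z' ∈ I.1 ∪ innerBoundary (zdGraph d) (box d (σ μ₂)), s(z, y) ∈ ω → s(z', y') ∈ ω →
                ω ∈ openConnIn (↑(I.1 ∪ innerBoundary (zdGraph d) (box d (σ μ₂))) : Set (Site d)) z z'} ∩
           {ω : BondConfig (Site d) | ∃ y ∈ I.2, ∃ z ∈ I.1 ∪ innerBoundary (zdGraph d) (box d (σ μ₂)), s(z, y) ∈ ω ∧
            ∃ r ∈ D.2, ∃ v ∈ D.1, ω ∈ openConnIn ((↑(I.1 ∪ innerBoundary (zdGraph d) (box d (σ μ₂))) : Set (Site d)) ∪ (↑D.1 \ ↑(box d (σ μ₂)))) z v ∧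
              s(v, r) ∈ ω} ∩
           {ω : BondConfig (Site d) | ω ∩ (↑((box d (σ M₂ + 1)).sym2) : Set (Sym2 (Site d))) ∈
            explEvent (↑(box d (σ M₁)) : Set (Site d)) ((↑(box d (σ M₂)) : Set (Site d)) \ ↑(box d (σ M₁))) ↑D.1 ↑D.2} ∩
           {ω : BondConfig (Site d) | ∀ r ∈ D.2, ∀ r' ∈ D.2, ∃ v ∈ D.1, ∃ v' ∈ D.1,
            s(v, r) ∈ ω ∧ s(v', r') ∈ ω ∧ ω ∈ openConnIn ((↑D.1 : Set (Site d)) \ ↑(box d (σ M₁ - 1))) v v'}))),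
        (bondPercolation (zdGraph d) p).real
        ((⋃ I ∈ (box d (σ μ₂ - 1) \ box d (σ μ₁ - 1)).powerset ×ˢ (innerBoundary (zdGraph d) (box d (σ μ₁ - 1))).powerset,
            ({ω : BondConfig (Site d) | ω ∩ (↑((box d (σ μ₂)).sym2) : Set (Sym2 (Site d))) ∈
                explEvent ((↑(box d (σ μ₂ - 1)) : Set (Site d))ᶜ) ((↑(box d (σ μ₂ - 1)) : Set (Site d)) \ ↑(box d (σ μ₁ - 1)))
                  ((↑(box d (σ μ₂ - 1)) : Set (Site d))ᶜ ∪ ↑I.1) ↑I.2} ∩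
             {ω : BondConfig (Site d) | ∀ y ∈ I.2, ∀ y' ∈ I.2, ∀ z ∈ I.1 ∪ innerBoundary (zdGraph d) (box d (σ μ₂)),
                ∀ z' ∈ I.1 ∪ innerBoundary (zdGraph d) (box d (σ μ₂)), s(z, y) ∈ ω → s(z', y') ∈ ω →
                ω ∈ openConnIn (↑(I.1 ∪ innerBoundary (zdGraph d) (box d (σ μ₂))) : Set (Site d)) z z'})) ∩
          ({ω : BondConfig (Site d) | ∃ x ∈ X, ∃ r ∈ D.2, ∃ v ∈ D.1, ω ∈ openConnIn ((↑D.1 : Set (Site d)) \ ↑H) x v ∧ s(v, r) ∈ ω} ∩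
           {ω : BondConfig (Site d) | ω ∩ (↑((box d (σ M₂ + 1)).sym2) : Set (Sym2 (Site d))) ∈
            explEvent (↑(box d (σ M₁)) : Set (Site d)) ((↑(box d (σ M₂)) : Set (Site d)) \ ↑(box d (σ M₁))) ↑D.1 ↑D.2} ∩
           {ω : BondConfig (Site d) | ∀ r ∈ D.2, ∀ r' ∈ D.2, ∃ v ∈ D.1, ∃ v' ∈ D.1,
            s(v, r) ∈ ω ∧ s(v', r') ∈ ω ∧ ω ∈ openConnIn ((↑D.1 : Set (Site d)) \ ↑(box d (σ M₁ - 1))) v v'})) *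
        (bondPercolation (zdGraph d) p).real {ω : BondConfig (Site d) | ∃ x ∈ D.2, ∃ t ∈ innerBoundary (zdGraph d) (box d N),
            ω ∈ openConnIn ((↑(box d N) : Set (Site d)) \ ↑D.1) x t} ∧
    ∑ D ∈ (((box d (σ M₂)).powerset.filter (fun U => box d (σ M₁) ⊆ U)) ×ˢ (box d (σ M₂ + 1)).powerset).filter (fun D =>
          0 < (bondPercolation (zdGraph d) p).real {ω : BondConfig (Site d) | ∃ x ∈ D.2, ∃ t ∈ innerBoundary (zdGraph d) (box d n),
            ω ∈ openConnIn ((↑(box d n) : Set (Site d)) \ ↑D.1) x t} ∧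
          0 < (bondPercolation (zdGraph d) p).real {ω : BondConfig (Site d) | ω ∩ (↑((box d (σ M₂ + 1)).sym2) : Set (Sym2 (Site d))) ∈
            explEvent (↑(box d (σ M₁)) : Set (Site d)) ((↑(box d (σ M₂)) : Set (Site d)) \ ↑(box d (σ M₁))) ↑D.1 ↑D.2} ∧
          0 < (∑ I ∈ (box d (σ μ₂ - 1) \ box d (σ μ₁ - 1)).powerset ×ˢ (innerBoundary (zdGraph d) (box d (σ μ₁ - 1))).powerset,
        (bondPercolation (zdGraph d) p).real {ω : BondConfig (Site d) | ∃ y ∈ I.2, ∃ w ∈ innerBoundary (zdGraph d) (box d (σ (σ mm + 1))),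
          ω ∈ openConnIn ((↑(box d (σ μ₂)) : Set (Site d)) \ (↑(I.1 ∪ innerBoundary (zdGraph d) (box d (σ μ₂))) ∪ ↑(box d (σ (σ mm + 1) - 1)))) y w} *
        (bondPercolation (zdGraph d) p).real
          ({ω : BondConfig (Site d) | ω ∩ (↑((box d (σ μ₂)).sym2) : Set (Sym2 (Site d))) ∈
                explEvent ((↑(box d (σ μ₂ - 1)) : Set (Site d))ᶜ) ((↑(box d (σ μ₂ - 1)) : Set (Site d)) \ ↑(box d (σ μ₁ - 1)))
                  ((↑(box d (σ μ₂ - 1)) : Set (Site d))ᶜ ∪ ↑I.1) ↑I.2} ∩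
           {ω : BondConfig (Site d) | ∀ y ∈ I.2, ∀ y' ∈ I.2, ∀ z ∈ I.1 ∪ innerBoundary (zdGraph d) (box d (σ μ₂)),
                ∀ z' ∈ I.1 ∪ innerBoundary (zdGraph d) (box d (σ μ₂)), s(z, y) ∈ ω → s(z', y') ∈ ω →
                ω ∈ openConnIn (↑(I.1 ∪ innerBoundary (zdGraph d) (box d (σ μ₂))) : Set (Site d)) z z'} ∩
           {ω : BondConfig (Site d) | ∃ y ∈ I.2, ∃ z ∈ I.1 ∪ innerBoundary (zdGraph d) (box d (σ μ₂)), s(z, y) ∈ ω ∧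
            ∃ r ∈ D.2, ∃ v ∈ D.1, ω ∈ openConnIn ((↑(I.1 ∪ innerBoundary (zdGraph d) (box d (σ μ₂))) : Set (Site d)) ∪ (↑D.1 \ ↑(box d (σ μ₂)))) z v ∧
              s(v, r) ∈ ω} ∩
           {ω : BondConfig (Site d) | ω ∩ (↑((box d (σ M₂ + 1)).sym2) : Set (Sym2 (Site d))) ∈
            explEvent (↑(box d (σ M₁)) : Set (Site d)) ((↑(box d (σ M₂)) : Set (Site d)) \ ↑(box d (σ M₁))) ↑D.1 ↑D.2} ∩
           {ω : BondConfig (Site d) | ∀ r ∈ D.2, ∀ r' ∈ D.2, ∃ v ∈ D.1, ∃ v' ∈ D.1,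
            s(v, r) ∈ ω ∧ s(v', r') ∈ ω ∧ ω ∈ openConnIn ((↑D.1 : Set (Site d)) \ ↑(box d (σ M₁ - 1))) v v'}))),
        (bondPercolation (zdGraph d) p).real
        ((⋃ I ∈ (box d (σ μ₂ - 1) \ box d (σ μ₁ - 1)).powerset ×ˢ (innerBoundary (zdGraph d) (box d (σ μ₁ - 1))).powerset,
            ({ω : BondConfig (Site d) | ω ∩ (↑((box d (σ μ₂)).sym2) : Set (Sym2 (Site d))) ∈
                explEvent ((↑(box d (σ μ₂ - 1)) : Set (Site d))ᶜ) ((↑(box d (σ μ₂ - 1)) : Set (Site d)) \ ↑(box d (σ μ₁ - 1)))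
                  ((↑(box d (σ μ₂ - 1)) : Set (Site d))ᶜ ∪ ↑I.1) ↑I.2} ∩
             {ω : BondConfig (Site d) | ∀ y ∈ I.2, ∀ y' ∈ I.2, ∀ z ∈ I.1 ∪ innerBoundary (zdGraph d) (box d (σ μ₂)),
                ∀ z' ∈ I.1 ∪ innerBoundary (zdGraph d) (box d (σ μ₂)), s(z, y) ∈ ω → s(z', y') ∈ ω →
                ω ∈ openConnIn (↑(I.1 ∪ innerBoundary (zdGraph d) (box d (σ μ₂))) : Set (Site d)) z z'})) ∩
          ({ω : BondConfig (Site d) | ∃ x ∈ X, ∃ r ∈ D.2, ∃ v ∈ D.1, ω ∈ openConnIn ((↑D.1 : Set (Site d)) \ ↑H) x v ∧ s(v, r) ∈ ω} ∩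
           {ω : BondConfig (Site d) | ω ∩ (↑((box d (σ M₂ + 1)).sym2) : Set (Sym2 (Site d))) ∈
            explEvent (↑(box d (σ M₁)) : Set (Site d)) ((↑(box d (σ M₂)) : Set (Site d)) \ ↑(box d (σ M₁))) ↑D.1 ↑D.2} ∩
           {ω : BondConfig (Site d) | ∀ r ∈ D.2, ∀ r' ∈ D.2, ∃ v ∈ D.1, ∃ v' ∈ D.1,
            s(v, r) ∈ ω ∧ s(v', r') ∈ ω ∧ ω ∈ openConnIn ((↑D.1 : Set (Site d)) \ ↑(box d (σ M₁ - 1))) v v'})) *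
        (bondPercolation (zdGraph d) p).real {ω : BondConfig (Site d) | ∃ x ∈ D.2, ∃ t ∈ innerBoundary (zdGraph d) (box d N),
            ω ∈ openConnIn ((↑(box d N) : Set (Site d)) \ ↑D.1) x t} ≤
      (bondPercolation (zdGraph d) p).real {ω : BondConfig (Site d) | ∃ x ∈ X, ∃ t ∈ innerBoundary (zdGraph d) (box d N),
            ω ∈ openConnIn ((↑(box d N) : Set (Site d)) \ ↑H) x t} := by
  classical
  have hσ0 := hσ (σ mm + 1) (by omega)
  have hστ0 := hστ (σ mm + 1) (by omega)
  have hmμ' : σ mm + 1 < μ₁ := hσm.reflect_lt (by omega)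
  have hσ1 := hσ μ₁ (by omega)
  have hστ1 := hστ μ₁ (by omega)
  have hμ12' : μ₁ < μ₂ := hσm.reflect_lt (by omega)
  have hσM1 := hσ M₁ (by omega)
  have hστM1 := hστ M₁ (by omega)
  have hM' : M₁ < M₂ := hσm.reflect_lt (by omega)
  have hσM2 := hσ M₂ (by omega)
  have hστM2 := hστ M₂ (by omega)
  have LS := sum_kernel_mul_conn_two_sided_junk p hϰ hσ hστ hσm hτm J hJ (μ₁ := μ₁) (μ₂ := μ₂) (M₁ := M₁) (M₂ := M₂) (n := N)
    (by omega) hμ12 hμM hM hN (hH.trans (box_mono d (by omega))) (hX.trans (box_mono d (by omega))) hXH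
  rw [Finset.sum_filter_of_ne]
  · refine ⟨le_trans (mul_le_mul_of_nonneg_right ?_ measureReal_nonneg) LS.1, LS.2⟩
    -- `1 − ε ≤ 1 − ϰ⁻² (J + J)`
    have hϰ2 : 0 < ϰ ^ 2 := by positivity
    have : ϰ⁻¹ ^ 2 * (J μ₁ μ₂ + J M₁ M₂) ≤ ε := by
      rw [inv_pow, inv_mul_le_iff₀ hϰ2]; exact hjunk
    linarith
  · -- dropped data contribute nothing
    intro D hD hne
    rw [Finset.mem_product, Finset.mem_filter, Finset.mem_powerset, Finset.mem_powerset] at hD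
    obtain ⟨⟨hUb, hUa⟩, hR⟩ := hD
    have hK0 := (mul_ne_zero_iff.1 hne).1
    have hγ0 := (mul_ne_zero_iff.1 hne).2
    have hγN : 0 < (bondPercolation (zdGraph d) p).real {ω : BondConfig (Site d) | ∃ x ∈ D.2, ∃ t ∈ innerBoundary (zdGraph d) (box d N),
            ω ∈ openConnIn ((↑(box d N) : Set (Site d)) \ ↑D.1) x t} :=
      lt_of_le_of_ne measureReal_nonneg (Ne.symm hγ0)
    have hdat : 0 < (bondPercolation (zdGraph d) p).real {ω : BondConfig (Site d) | ω ∩ (↑((box d (σ M₂ + 1)).sym2) : Set (Sym2 (Site d))) ∈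
            explEvent (↑(box d (σ M₁)) : Set (Site d)) ((↑(box d (σ M₂)) : Set (Site d)) \ ↑(box d (σ M₁))) ↑D.1 ↑D.2} :=
      lt_of_lt_of_le (lt_of_le_of_ne measureReal_nonneg (Ne.symm hK0)) (kernel_le_dat_aspect p σ mm μ₁ μ₂ M₁ M₂ H X D.1 D.2)
    have hRb : ∀ r ∈ D.2, r ∉ box d (σ M₂) := fun r hr hrb =>
      hdat.ne' (real_dat_eq_zero_of_mem_box p (hσm hM'.le) hUb hr hrb)
    refine ⟨real_conn_pos_of_real_conn_pos p hp (b := σ M₂) (by omega) hNn hUb hγN, hdat, ?_⟩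
    refine lt_of_le_of_ne (Finset.sum_nonneg fun I _ => mul_nonneg measureReal_nonneg measureReal_nonneg) fun h0 => hK0 ?_
    exact kernel_eq_zero_of_beta_eq_zero_aspect p hϰ hσ hστ hσm hA2 hmμ hμ12 hμM hM'.le hH hX hXH hUa hUb hR hRb h0.symm


end Summit.CriticalPhenomena.PercolationContinuityZ3.Theorems.Crossing

end
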